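import Summits.Ventures.Crystal3D.Theorems.StickyWulffConstantGenericWallFloorHStarSingle
import Summits.Ventures.Crystal3D.Theorems.StickyWulffConstantGenericWallFloorSaturationStructure
import Summits.Ventures.Crystal3D.Theorems.StickyWulffConstantGenericWallFloorCredits
import HarnessLib

/-!
# E1h REPAIRED BY THE RESIDUE RULE: the END of an h-row pays within distance 1 (crux `GenericWallFloor`, stmt-Ventures-19480, kernel G;
# line «LAYER ROWS», cf-p1 RULING (ccxlii) repair programme E1h-R, machine owner 19480-p2 g15)

HONEST FRAMING. Venture `Summits/Ventures/Crystal3D` (cell `crystal3d-full`), route `route-Ventures-StickyWulffConstant`, helper for the crux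
`GenericWallFloor` (stmt-Ventures-19480) / consumer `TextureLiminfV5` (stmt-Ventures-23912), lane T registered stub `stub_layerRows`.  Structural
theorems about finite `1`-separated configurations; the two kissing facts `KissingGap (5/2)`, `KissingClassification (5/2)` (lane T's registered
`stub_kissing`, tree theorems of computational grade) enter as HYPOTHESES, so the axioms are the standard ones; clean import closure
(RULING (ccxxxix)); F-C1 not moved.

THE POINT.  The h-row walk (`…GenericWallFloorHRowWalk`) paid at its END `y` through E1h (`ExactOnly 0 (hStar u₀)`, orbit A12-583), which is
FALSE (`not_stub_E1h`, …HStarRefuted: an exact twelve-ball completion of the equatorial closed star that is not close-packed — the twisted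
quadruple on the forward hexagon edge).  The repair needs no new certificate: at an END the walker's ball `y` owns the star (its predecessor is
h-full, `hRow_owns_star`) and has an EMPTY h-slot site (`not_full_of_hRowStep_eq_none`).  If `y` has twelve contacts, its contact dozen is NOT
close-packed — a close-packed dozen containing the star is the h-dozen `y + F·hcpSlots` itself (`singleDozen_hStar`, PROVED), all of whose sites
would then be occupied — so by the RESIDUE RULE (`two_unsaturated_of_not_closePacked`, …SaturationStructure, from GAP(5/2) ∧ CLASSIFICATION(5/2))
`y` has TWO contact neighbours with at most eleven contacts.  Hence:
* **`hRow_end_pays_within_one`** — at an END, `y` itself has `≤ 11` contacts, or two distinct contact neighbours of `y` do;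
* `hRow_end_exists_payer` — the pooled form: some `b ∈ X` with `dist y b ≤ 1` has `≤ 11` contacts;
* **`hRow_end_residue`** — the run form (as `hRow_end`): with fuel `N`, `r·N > H − ⟪y, z⟫`, the run stops at a ball of `X`, `n ≤ N` steps from the
  start, with a payer within distance `1`.
WHAT THIS IS NOT: the re-plumbed family / ledger / R1″ (…HRowRunResidue, …BarlowHRowFamilyResidue, …LayerRowsLedgerResidue, …LayerRowsInPlaneResidue
follow); no certificate is proved here; F-C1 not moved.
-/

noncomputable section

namespace Summit.Ventures.Crystal3D.Theorems

open Finset Summit.Ventures.Crystal3D Literature.Geometry.DiscreteGeometry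
open scoped InnerProductSpace

variable {X : Finset (EuclideanSpace ℝ (Fin 3))}

/-- **At an h-row END a twelve-fold ball has a NON-close-packed shell.**  Under `HRowInv` (the star of the arrival slot is owned) and
`hRowStep = none` (an h-slot site is empty), the contact neighbours of `y` are not arranged in the fcc or the hcp pattern. -/
theorem hRow_end_not_arranged
    {F : EuclideanSpace ℝ (Fin 3) ≃ₗᵢ[ℝ] EuclideanSpace ℝ (Fin 3)} {u y : EuclideanSpace ℝ (Fin 3)}
    (hu : u ∈ fccSlots) (hu2 : u 2 = 0) (hI : HRowInv X F u y) (hstop : hRowStep X F u y = none) :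
    ¬ (IsArrangedIn ((fun q => (2 : ℝ) • (q - y)) '' {q | q ∈ X ∧ dist y q = 1}) fccKissingPattern ∨
      IsArrangedIn ((fun q => (2 : ℝ) • (q - y)) '' {q | q ∈ X ∧ dist y q = 1}) hcpKissingPattern) := by
  classical
  intro harr
  -- the contact dozen `D` of `y` is close-packed
  set D : Finset (EuclideanSpace ℝ (Fin 3)) := X.filter fun q => dist y q = 1 with hD
  have hcp : IsClosePackedDozenAt y D := by
    rcases harr with h | h
    · obtain ⟨B, h1, h2⟩ := neighbours_eq_of_isArrangedIn h
      refine ⟨B, Or.inl ?_⟩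
      ext q
      simp only [hD, coe_filter, Set.mem_setOf_eq, Set.mem_image, mem_coe]
      constructor
      · rintro ⟨hq, hdq⟩
        obtain ⟨p, hp, rfl⟩ := h2 q hq hdq
        exact ⟨p, hp, add_comm _ _⟩
      · rintro ⟨p, hp, rfl⟩
        have := h1 p hp
        rw [add_comm] at this
        exact this
    · obtain ⟨B, h1, h2⟩ := neighbours_eq_of_isArrangedIn h
      refine ⟨B, Or.inr ?_⟩
      ext q
      simp only [hD, coe_filter, Set.mem_setOf_eq, Set.mem_image, mem_coe]
      constructor
      · rintro ⟨hq, hdq⟩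
        obtain ⟨p, hp, rfl⟩ := h2 q hq hdq
        exact ⟨p, hp, add_comm _ _⟩
      · rintro ⟨p, hp, rfl⟩
        have := h1 p hp
        rw [add_comm] at this
        exact this
  -- the star of the arrival slot lies in `D`
  have hstar : ((hStar u).image fun s => y + F s) ⊆ D := by
    intro q hq
    obtain ⟨s, hs, rfl⟩ := mem_image.1 hq
    rw [hStar_eq, mem_filter] at hs
    refine mem_filter.2 ⟨hRow_owns_star hu hu2 hI hs.1 hs.2, ?_⟩
    rw [dist_eq_norm, sub_add_cancel_left, norm_neg, LinearIsometryEquiv.norm_map, norm_eq_one_of_mem_hcpSlots hs.1]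
  -- hence `D` is the whole h-dozen `y + F·hcpSlots` (the hand lemma, transported)
  have hsingle : SingleDozen y (hcpSlots.image fun s => y + F s) ((hStar u).image fun s => y + F s) := by
    have h0 := (singleDozen_hStar hu hu2).image F y
    rw [map_zero, zero_add, image_frame_add_comm, image_frame_add_comm] at h0
    exact h0
  have hDeq : D = hcpSlots.image fun s => y + F s := hsingle D hcp hstar
  -- but one h-slot site is empty
  obtain ⟨w, hw, hwX⟩ := not_full_of_hRowStep_eq_none F hstop
  have hmem : y + F w ∈ D := by rw [hDeq]; exact mem_image.2 ⟨w, hw, rfl⟩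
  exact hwX (mem_filter.1 hmem).1

/-- **THE END OF AN h-ROW PAYS WITHIN DISTANCE 1 (residue rule).**  Under GAP(`δ`) ∧ CLASSIFICATION(`δ`): at an END (`HRowInv`, `hRowStep = none`)
either `y` has at most eleven contacts, or two distinct contact neighbours of `y` have at most eleven contacts each. -/
theorem hRow_end_pays_within_one {δ : ℝ} (hg : KissingGap δ) (hc : KissingClassification δ)
    (hX : ∀ p ∈ X, ∀ q ∈ X, p ≠ q → 1 ≤ dist p q)
    {F : EuclideanSpace ℝ (Fin 3) ≃ₗᵢ[ℝ] EuclideanSpace ℝ (Fin 3)} {u y : EuclideanSpace ℝ (Fin 3)}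
    (hu : u ∈ fccSlots) (hu2 : u 2 = 0) (hI : HRowInv X F u y) (hstop : hRowStep X F u y = none) :
    (X.filter fun q => dist y q = 1).card ≤ 11 ∨
      ∃ b ∈ X, ∃ b' ∈ X, b ≠ b' ∧ dist y b = 1 ∧ dist y b' = 1 ∧
        (X.filter fun q => dist b q = 1).card ≤ 11 ∧ (X.filter fun q => dist b' q = 1).card ≤ 11 := by
  classical
  have h12 := card_filter_dist_eq_one_le_twelve X hX y
  by_cases hsat : (X.filter fun q => dist y q = 1).card = 12
  · right
    obtain ⟨b, hb, b', hb', hne, hdb, hdb', hb12, hb'12⟩ :=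
      two_unsaturated_of_not_closePacked hg hc hX hsat (hRow_end_not_arranged hu hu2 hI hstop)
    have hble := card_filter_dist_eq_one_le_twelve X hX b
    have hb'le := card_filter_dist_eq_one_le_twelve X hX b'
    exact ⟨b, hb, b', hb', hne, hdb, hdb', by omega, by omega⟩
  · left; omega

/-- **Pooled form**: at an END some ball of `X` within distance `1` of `y` (possibly `y` itself) has at most eleven contacts. -/
theorem hRow_end_exists_payer {δ : ℝ} (hg : KissingGap δ) (hc : KissingClassification δ)
    (hX : ∀ p ∈ X, ∀ q ∈ X, p ≠ q → 1 ≤ dist p q)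
    {F : EuclideanSpace ℝ (Fin 3) ≃ₗᵢ[ℝ] EuclideanSpace ℝ (Fin 3)} {u y : EuclideanSpace ℝ (Fin 3)}
    (hu : u ∈ fccSlots) (hu2 : u 2 = 0) (hI : HRowInv X F u y) (hstop : hRowStep X F u y = none) :
    ∃ b ∈ X, dist y b ≤ 1 ∧ (X.filter fun q => dist b q = 1).card ≤ 11 := by
  rcases hRow_end_pays_within_one hg hc hX hu hu2 hI hstop with h | ⟨b, hb, -, -, -, hdb, -, hb11, -⟩
  · exact ⟨y, hI.1, by rw [dist_self]; exact zero_le_one, h⟩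
  · exact ⟨b, hb, hdb.le, hb11⟩

/-- **THE END OF AN h-ROW, residue form** (replaces `hRow_end` / `hRow_end_of_model`): in-plane slot `u`, frame `F`, GAP ∧ CLASSIFICATION; fuel `N` with
`r·N > H − ⟪y, z⟫` (any real `r ≤ ⟪F u, z⟫`, `H` bounding `⟪p, z⟫` on `X`).  Then the run from a state satisfying `HRowInv` has STOPPED at a ball of
`X`, `n ≤ N` steps `F u` from `y`, with `HRowInv` there, and some ball of `X` within distance `1` of the end has at most eleven contacts. -/
theorem hRow_end_residue {δ : ℝ} (hg : KissingGap δ) (hc : KissingClassification δ)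
    (hX : ∀ p ∈ X, ∀ q ∈ X, p ≠ q → 1 ≤ dist p q)
    {F : EuclideanSpace ℝ (Fin 3) ≃ₗᵢ[ℝ] EuclideanSpace ℝ (Fin 3)} {u : EuclideanSpace ℝ (Fin 3)} (hu : u ∈ fccSlots) (hu2 : u 2 = 0)
    {z : EuclideanSpace ℝ (Fin 3)} {r H : ℝ} (hrise : r ≤ ⟪F u, z⟫_ℝ)
    (hH : ∀ p ∈ X, ⟪p, z⟫_ℝ ≤ H) {y : EuclideanSpace ℝ (Fin 3)} (hI : HRowInv X F u y) {N : ℕ} (hN : H - ⟪y, z⟫_ℝ < r * N) :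
    ∃ n : ℕ, n ≤ N ∧ hRowRun X F u N y = y + (n : ℝ) • F u ∧ hRowRun X F u N y ∈ X ∧ HRowInv X F u (hRowRun X F u N y) ∧
      hRowStep X F u (hRowRun X F u N y) = none ∧
      ∃ b ∈ X, dist (hRowRun X F u N y) b ≤ 1 ∧ (X.filter fun q => dist b q = 1).card ≤ 11 := by
  obtain ⟨n, hn, hrun, hInv, hend⟩ := hRowRun_spec hu hu2 N hI
  have hstop : hRowStep X F u (hRowRun X F u N y) = none := by
    rcases hend with h | h
    · -- all the fuel was used: the walker would be above `H`
      exfalso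
      subst h
      have h1 := hH _ hInv.1
      rw [hrun, inner_add_left, inner_smul_left] at h1
      simp only [RCLike.conj_to_real] at h1
      have h2 : r * (n : ℝ) ≤ (n : ℝ) * ⟪F u, z⟫_ℝ := by
        rw [mul_comm]; exact mul_le_mul_of_nonneg_left hrise (Nat.cast_nonneg n)
      linarith
    · exact h
  exact ⟨n, hn, hrun, hInv.1, hInv, hstop, hRow_end_exists_payer hg hc hX hu hu2 hInv hstop⟩

end Summit.Ventures.Crystal3D.Theorems

end
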